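import Literature.NumberTheory.FaltingsSerre.Paramodular587plus
import HarnessLib

/-!
# The Faltings–Serre method after Brumer–Pacetti–Poor–Tornaría–Voight–Yuen, IX′:
# the instance `N = 587`, Fricke sign `−` — a RE-CERTIFICATION of [BPPTVY, Thm 7.3.1 p. 1191]
# (certificate `certs/587/minus/certificate.canonical.json`, sha256 `3ecc7fdaad431fe1…`)

[BPPTVY] = A. Brumer, A. Pacetti, C. Poor, G. Tornaría, J. Voight, D. S. Yuen, *On the paramodularity of
typical abelian surfaces*, Algebra & Number Theory **13**:5 (2019) 1145–1195 [cite: BrumerEtAl2019].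
[PY15] = C. Poor, D. S. Yuen, *Paramodular cusp forms*, Math. Comp. **84** (2015) 1401–1438
[cite: PoorYuen2015] (Thm 1.1 p. 1402; Table 5 p. 1433, column `587`, `ε = −`).

THE PUBLISHED THEOREM.  [BPPTVY, Thm 7.3.1 p. 1191]: `A₅₈₇ = Jac(C⁻)`, `C⁻ : y² + (x³+x+1)y = −x²−x`
(LMFDB `587.a.587.1`, conductor `587`, root number `−1`), is paramodular: for all primes `p`,
`L_p(A₅₈₇,T) = Q_p(f⁻₅₈₇,T)`, where `f⁻₅₈₇` spans `S₂(K(587))⁻` and is the Borcherds product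
(6.2.8)–(6.2.9) p. 1180 (Gritsenko–Poor–Yuen), with `Q₂(f⁻₅₈₇,T) = 1+3T+5T²+6T³+4T⁴`,
`Q₃(f⁻₅₈₇,T) = 1+4T+9T²+12T³+9T⁴` ((6.2.10) p. 1180); the proof (p. 1191–1192) prints the residual
data `Q₃ ≡ 1+T²+T⁴`, `Q₁₁ = 1+T−T²+11T³+121T⁴ ≡ 1+T+T²+T³+T⁴ (mod 2)`, the `2`-division sextic
`x⁶−2x⁵+2x⁴−x²+2x−1` (group `S₆`), the degree-`20` field (7.3.2) with its `2¹⁹−1` quadratic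
extensions, and the check set (7.3.3) `{3,5,7,11,13,17,19,23,29,37,41}`.

WHAT THIS FILE IS.  The `N = 587`, sign `−` INSTANCE of the template `paramodular_of_surfaceCertificate`
(`ParamodularTemplate.lean`), in exactly the shape of `Paramodular349/353/461/587plus.lean`, recording the
cell's independent RE-CERTIFICATION of the printed theorem by its two-implementation pipeline (it is not
a new result, and the typed conclusion `IsParamodularAwayFrom A 587 f` is the printed statement
restricted to `p ≠ 587`).  The check set is `Paramodular587plus.checkPrimes587plus` — ONE set for both
Fricke signs, since Alg 2.4.1 sees only `(ρ̄_{A}, S)` and `ℚ(A⁺[2]) = ℚ(A⁻[2])` (`Paramodular587plus.lean`,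
`Paramodular587plusCore.lean`; the companion cited-form instance `Paramodular587minusCited.lean` uses the
same set).  `A⁻` is paramodular of level `587` away from `587`, GIVEN (i) the cited Faltings–Serre
criterion `hFS` ([BPPTVY, Thm 2.1.5]; discharged in `CriterionProofs.lean` by
`traceEq_of_faltingsSerre_symplectic_holds`), (ii) the Arthur-dependent input `hρf` ([BPPTVY, Thm 4.3.4]),
and (iii) the CERTIFICATE `Certificate587minus`, a hypothesis discharged OUTSIDE THE KERNEL by the merged
certificate `certs/587/minus/certificate.canonical.json`
(sha256 `3ecc7fdaad431fe1aa2cebdb3d9fd053bdbf5c23e813cbf52062eb7b084bc5cd`, verdict `certified`,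
GRH-free), every load-bearing datum by (at least) two code-disjoint implementations and equal:
* Galois half (engineer-1, cited by hash `5ba9346a657202460934ea21b5dd12813c66f8395b03112b83a27684d831ddaf`):
  conductor `587` and Euler factors of `A⁻` (PARI `hyperellcharpoly` / naive point counts, agreeing at
  the 52 common primes; four further seats at the check primes), `2`-division sextic with group `S₆`
  (= the printed one), `K₀` = the printed degree-`20` field, `Cl_S(K₀) = 1`, `dim K₀(S,2) = 19`, the
  obstruction / witness search over the `2¹⁹−1` quadratic extensions ⇒ `P(587)` = the printed (7.3.3);
* form side (engineer-2 register, sha256 `040464882f25b1ea9a3babb8cab5d36ca18ff64e4e5e6e173640dc8138dacd41`):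
  `λ_p(f⁻₅₈₇)`, `p ≤ 43`, by FOUR code-disjoint engines (two Fourier–Jacobi evaluations of the Borcherds
  product, two restriction engines after [BPPTVY, §6.3–6.5]) at `p ≤ 11` and three at `13 ≤ p ≤ 43`;
  `b_p` at `p = 2,3,5,7,11` by two METHODS (coefficient ratio; `T₁(p²)` on the restricted product), so
  `Q_p(f⁻₅₈₇) = L_p(A⁻)` exactly at `p ≤ 11`: `1+3T+5T²+6T³+4T⁴`, `1+4T+9T²+12T³+9T⁴`,
  `1+2T+T²+10T³+25T⁴`, `1−5T²+49T⁴`, `1+T−T²+11T³+121T⁴` (= printed (6.2.10) and p. 1191);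
* residual identification `ρ̄_f ≃ ρ̄_A`: OF RECORD by Route E (literature seat, sha256
  `ee4d40a17fe8b539cea5013bea2c410b6ef204c071080405f9d4bb34bb534961`: étale-algebra sieve over the 160
  candidate algebras unramified outside `{2,587}` from the LMFDB lists — completeness CITED —, sole
  survivor `6.2.37568.1 = E(ρ̄_A)`, two implementations + a referee re-run, kernel lemma
  `GSp4F2.rank_iota_sub_one_le_one_iff`), CROSS-CHECKED by the printed route (`Q₃`, `Q₁₁ mod 2` as above,
  each coefficient ×2 on both sides, against engineer-1's complete candidate lists);
* trace check on `checkPrimes587plus`: `a_p(A⁻) = λ_p(f⁻₅₈₇) = −4,−2,0,−1,−2,0,−7,−5,5,−4,1`, each side ×2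
  (= [PY15, Table 5]: `λ₃ = −4, λ₅ = −2, λ₇ = 0, λ₁₁ = −1`); not a lift (`λ₃ = −4`: `|λ₃−4| > 2√3`).
-/

noncomputable section

namespace Literature.NumberTheory.FaltingsSerre.Paramodular587minus

open Polynomial IsDedekindDomain
open Literature.NumberTheory.FaltingsSerre Literature.NumberTheory.GaloisRepresentations
  Literature.NumberTheory.Automorphic.Paramodular Literature.NumberTheory.Automorphic
  Literature.AlgebraicGeometry.Motives Literature.NumberTheory.FaltingsSerre.Paramodular587plus
open scoped NumberField

/-- **The `N = 587`, sign `−` certificate, as a hypothesis**: `SurfaceCertificate 587 checkPrimes587plus J ν ρA ρf`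
(`ParamodularTemplate.lean`; fields `similitude₁₂`, `det_isUnit`, `transpose_eq`, `diag_eq`,
`unramified₁₂`, `absIrreducible`, `residual_eq`, `complete`, `traces` of `Certificate`).  As a family of
propositions in `(J, ν, ρA, ρf)` it coincides with `Certificate587plus` — the Fricke sign lives in WHICH
surface and form `ρA`, `ρf` come from, not in `(N, T)`; it is discharged OUTSIDE THE KERNEL, for the framed
`2`-adic representations of `A⁻ = Jac(587.a.587.1)` and of `f⁻₅₈₇`, by
`certs/587/minus/certificate.canonical.json` (sha256 `3ecc7fdaad431fe1aa2cebdb3d9fd053bdbf5c23e813cbf52062eb7b084bc5cd`)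
— blocks `residual` (image `S₆ = Sp₄(𝔽₂)`; `ρ̄_f ≃ ρ̄_A` by Route E, survivor `6.2.37568.1`, cross-checked by
the printed `Q₃, Q₁₁ mod 2` route), `classfield`/`group_theory`/`obstructing` (engineer-1 Galois half by
hash `5ba9346a…`: `K₀` of degree 20, `Cl_S(K₀) = 1` GRH-free twice, check primes = printed (7.3.3) =
`checkPrimes587plus`), `trace_check` (`a_p(A⁻) = λ_p(f⁻₅₈₇)` on `checkPrimes587plus`:
`−4,−2,0,−1,−2,0,−7,−5,5,−4,1`, each side by two implementations). [cite: BrumerEtAl2019, Thm 7.3.1 p. 1191; Alg 2.4.1 p. 1156; Thm 2.1.5 p. 1150] -/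
def Certificate587minus (J : Matrix (Fin 4) (Fin 4) ℤ_[2]) (ν : Field.absoluteGaloisGroup ℚ → ℤ_[2])
    (ρA ρf : FramedGaloisRep ℚ ℤ_[2] 4) : Prop :=
  SurfaceCertificate 587 checkPrimes587plus J ν ρA ρf

/-- **`A⁻ = Jac(C⁻)`, `C⁻ = 587.a.587.1`, is paramodular of level `587` away from `587`, with partner
`f⁻₅₈₇`, from the certificate** — the cell's re-certification of [BPPTVY, Thm 7.3.1] restricted to
`p ≠ 587`.  Binders as in `paramodular_of_surfaceCertificate` with `N = 587`, `T = checkPrimes587plus`,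
except that the Euler factor at `2` is pinned to its printed value on both sides:
`L₂(A⁻,T) = Q₂(f⁻₅₈₇,T) = 1+3T+5T²+6T³+4T⁴`, i.e. `(a₂, b₂) = (−3, 5)` (`h2A`: PARI / naive counts /
two further seats; `h2f`: four engines, `b₂` by two methods; [BPPTVY, (6.2.10) p. 1180]; [PY15, Table 5]:
`λ₂ = −3`, `λ₄ = 3`). [cite: BrumerEtAl2019, Thm 7.3.1 p. 1191; Thm 2.1.5 p. 1150; Thm 4.3.4 p. 1169; Alg 2.4.1 p. 1156; (6.2.10) p. 1180] -/
theorem paramodular_587minus (hFS : traceEq_of_faltingsSerre_symplectic)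
    {A : AbelianVariety ℚ} {f : Matrix (Fin 2) (Fin 2) ℂ → ℂ}
    {ρA ρf : FramedGaloisRep ℚ ℤ_[2] 4} {J : Matrix (Fin 4) (Fin 4) ℤ_[2]}
    {ν : Field.absoluteGaloisGroup ℚ → ℤ_[2]}
    {b : Module.Basis (Fin 4) ℚ_[2] (A.rationalTateModule 2)}
    (hC : Certificate587minus J ν ρA ρf)
    (hframe : A.IsFrameOfTateRep 2 b (rationalize ρA))
    (aA bA af bf : ℕ → ℤ)
    (hA : ∀ p : ℕ, p.Prime → ¬ p ∣ 587 →
      A.HasGoodEulerFactorAt p ((lPolynomialOfSurface p (aA p) (bA p)).map (Int.castRingHom ℚ)))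
    (hρf : ∀ p : ℕ, p.Prime → ¬ p ∣ 587 → p ≠ 2 →
      ∀ v : HeightOneSpectrum (𝓞 ℚ), ((p : ℕ) : 𝓞 ℚ) ∈ v.asIdeal →
        ρf.HasFrobCharpolyAt v
          ((lPolynomialOfSurface p (af p) (bf p)).reverse.map (Int.castRingHom ℤ_[2])))
    (hcusp : IsParamodularCuspForm 587 2 f) (hne : ∃ Z ∈ siegelUpperHalfSpace 2, f Z ≠ 0)
    (hfe : ∀ p : ℕ, p.Prime → ¬ p ∣ 587 →
      HasSpinorEulerFactorAt 2 p f ((lPolynomialOfSurface p (af p) (bf p)).map (Int.castRingHom ℂ)))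
    (h2A : aA 2 = -3 ∧ bA 2 = 5) (h2f : af 2 = -3 ∧ bf 2 = 5) :
    IsParamodularAwayFrom A 587 f :=
  paramodular_of_surfaceCertificate hFS hC hframe aA bA af bf hA hρf hcusp hne hfe
    (fun _ => ⟨h2A.1.trans h2f.1.symm, h2A.2.trans h2f.2.symm⟩)

/-- The printed Euler factor at `2` as a polynomial identity: with `(a₂, b₂) = (−3, 5)`,
`lPolynomialOfSurface 2 (−3) 5 = 1 + 3T + 5T² + 6T³ + 4T⁴` = `Q₂(f⁻₅₈₇,T)` of [BPPTVY, (6.2.10)]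
= `L₂(A⁻,T)` (certificate blocks `curve_euler.L_2` and `form_euler.euler_factor_rows`); at any prime
`p ≠ 587` the agreement of the two Euler factors is `Paramodular587plus.eulerFactors_agree_587plus`
(level `587`, either sign). [cite: BrumerEtAl2019, (6.2.10) p. 1180] -/
theorem eulerFactor_two_587minus :
    lPolynomialOfSurface 2 (-3) 5 = 1 + C 3 * X + C 5 * X ^ 2 + C 6 * X ^ 3 + C 4 * X ^ 4 := by
  simp only [lPolynomialOfSurface, Nat.cast_ofNat, map_neg, neg_mul, sub_neg_eq_add, mul_neg, map_mul]
  norm_num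

end Literature.NumberTheory.FaltingsSerre.Paramodular587minus

end
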